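import Mathlib.LinearAlgebra.Matrix.Determinant.Basic
import Mathlib.LinearAlgebra.Matrix.NonsingularInverse
import Mathlib.RingTheory.LocalRing.MaximalIdeal.Basic
import HarnessLib

/-!
# Crux `HLiu418`, Track B road `K2_Liu`, unit U5 «DOUBLING ZETA», socket #16 ∕ #16a (organ (IV-b∕c)) — helper «F1b»:
# the column Cauchy–Binet expansion `det (A · B) = Σ_φ det A_φ · Π_i B_{φ(i) i}` and a UNIT maximal minor of the bottom block of an
# invertible matrix over a local ring

Cell `hodgecm-mathlib`, crux item hLiu418 = `stmt-HodgeConjecture-24832`, route of record `HCCMUnconditional`; squad K2 ∕ K2Liu, prover K2Liu-p04 (g0)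
(lineage of socket #16 `sig_K2LiuDoublingHeightDecay`; LEAD F0P6-plan (g10) 21:27:24Z «continue (IV-c) algebraic core»).  THEOREMS ONLY over an
arbitrary commutative (resp. local) ring — pure Mathlib; no `def`, no instance, no notation, no `sorry`; lane `--supports stmt-HodgeConjecture-24832
--as helper` (count-neutral).  Sequel of ★ `Theorems/K2LiuPluckerMinors` (F1, p854930).

WHY.  The Plücker height of record `Φ₀(h) = H(π(h))^{-1∕2}` (design note K2/STATUS 21:28:54Z; `π(h)` = the maximal minors of the bottom `n × 2n`
block of `E₁ · blk h · E₂`, indexed by ALL column selections `φ : Fin n → Fin n ⊕ Fin n`) needs, besides F1, the fact that `π(h)` has FINITE HEIGHT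
DATA (★ `AdelicVectorHeight.IsHeightFinite`): at almost every finite place some coordinate of `π(h_v)` is a `v`-adic UNIT.  Mathlib (2026-09) has no
Cauchy–Binet formula; the function-indexed («unsymmetrised») expansion below has a five-line proof and suffices:

* §1 `det_mul_eq_sum_det_submatrix_mul_prod` — **`det (A B) = Σ_{φ : m → k} det (A.submatrix id φ) · Π_i B (φ i) i`** for `A : m × k`,
  `B : k × m` over any commutative ring (expand `Π_i Σ_j`; the non-injective `φ` contribute vanishing determinants but need not be removed);
* §2 `exists_isUnit_det_submatrix_of_mul_eq_one` — over a LOCAL ring, `A B = 1 ⇒` some maximal minor `det (A.submatrix id φ)` is a unit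
  (else every summand of §1 lies in the maximal ideal, so would `det 1 = 1`);
* §3 `bottom_mul_rightCols_inv`, `exists_isUnit_bottom_minor` — for an invertible `M` on `ι ⊕ ι` over a local ring, bottom(`M`) · rightcols(`M⁻¹`) `= 1`,
  hence **some maximal minor of the bottom row-block of `M` is a unit** (applied at `M = E₁ blk(h_v) E₂ ∈ GL_{2n}(𝒪_v)` for almost all `v`, this is
  the unit coordinate of `π(h)`; with «entries integral ⇒ minors integral» it gives local Plücker height `= 1` a.e., i.e. `IsHeightFinite`).

HONEST LABEL.  Count-neutral algebra helper; the height leaf, #16a and #16b are separate files.  `HC_CM` is proved only modulo the 7 printed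
citations (2 remaining named inputs: hLiu418 = `stmt-HodgeConjecture-24832`, h413 = `stmt-HodgeConjecture-24833`) until rung 0 closes.
-/

set_option autoImplicit false
-- the mandated namespace repeats the single-problem summit's segment (`HodgeConjecture.HodgeConjecture`)
set_option linter.dupNamespace false

namespace Summit.HodgeConjecture.HodgeConjecture.Cruxes.HLiu418.K2LiuCauchyBinetMinors

/-! ## §1 The column Cauchy–Binet expansion -/

/-- **`det (A · B) = Σ_{φ : m → k} det (A.submatrix id φ) · Π_i B (φ i) i`** (Cauchy–Binet, unsymmetrised: the sum runs over ALL maps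
`φ`, the non-injective ones having `det (A.submatrix id φ) = 0`).  [cite: GelbartPiatetskishapiroRallis1987, Part A §1] -/
theorem det_mul_eq_sum_det_submatrix_mul_prod {R : Type*} [CommRing R] {m k : Type*} [Fintype m] [DecidableEq m] [Fintype k]
    [DecidableEq k] (A : Matrix m k R) (B : Matrix k m R) :
    (A * B).det = ∑ φ : m → k, (A.submatrix id φ).det * ∏ i, B (φ i) i := by
  simp only [Matrix.det_apply', Matrix.mul_apply, Finset.prod_univ_sum, Finset.mul_sum, Finset.sum_mul,
    Matrix.submatrix_apply, id]
  rw [Finset.sum_comm]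
  refine Finset.sum_congr rfl fun φ _ => Finset.sum_congr rfl fun σ _ => ?_
  rw [mul_assoc, ← Finset.prod_mul_distrib]

/-! ## §2 A unit maximal minor from a right inverse (local rings) -/

/-- **Over a local ring, `A · B = 1` forces some maximal minor of `A` to be a unit**: otherwise every summand of the Cauchy–Binet expansion
of `det (A B) = 1` lies in the maximal ideal. [folklore] -/
theorem exists_isUnit_det_submatrix_of_mul_eq_one {R : Type*} [CommRing R] [IsLocalRing R] {m k : Type*} [Fintype m]
    [DecidableEq m] [Fintype k] [DecidableEq k] (A : Matrix m k R) (B : Matrix k m R) (h : A * B = 1) :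
    ∃ φ : m → k, IsUnit (A.submatrix id φ).det := by
  by_contra hne
  simp only [not_exists] at hne
  have hsum : ∑ φ : m → k, (A.submatrix id φ).det * ∏ i, B (φ i) i ∈ IsLocalRing.maximalIdeal R :=
    sum_mem fun φ _ => Ideal.mul_mem_right _ _ ((IsLocalRing.mem_maximalIdeal _).2 (hne φ))
  rw [← det_mul_eq_sum_det_submatrix_mul_prod, h, Matrix.det_one] at hsum
  exact (IsLocalRing.mem_maximalIdeal _).1 hsum isUnit_one

/-! ## §3 The bottom row-block of an invertible matrix on `ι ⊕ ι` -/

/-- bottom(`M`) · rightcols(`N`) is the `(2,2)` corner of `M · N`; for `N = M⁻¹` it is `1`. [folklore] -/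
theorem bottom_mul_rightCols {R : Type*} [CommRing R] {ι : Type*} [Fintype ι] [DecidableEq ι]
    (M N : Matrix (ι ⊕ ι) (ι ⊕ ι) R) :
    M.submatrix Sum.inr id * N.submatrix id Sum.inr = (M * N).submatrix Sum.inr Sum.inr := by
  rw [Matrix.submatrix_mul M N Sum.inr id Sum.inr Function.bijective_id]

/-- `(1 : Matrix (ι ⊕ ι)).submatrix inr inr = 1`. [folklore] -/
theorem one_submatrix_inr_inr {R : Type*} [CommRing R] {ι : Type*} [DecidableEq ι] :
    (1 : Matrix (ι ⊕ ι) (ι ⊕ ι) R).submatrix Sum.inr Sum.inr = 1 := by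
  ext i j
  simp [Matrix.one_apply]

/-- For an invertible `M` (`det M` a unit): bottom(`M`) · rightcols(`M⁻¹`) `= 1`. [folklore] -/
theorem bottom_mul_rightCols_inv {R : Type*} [CommRing R] {ι : Type*} [Fintype ι] [DecidableEq ι]
    (M : Matrix (ι ⊕ ι) (ι ⊕ ι) R) (hM : IsUnit M.det) :
    M.submatrix Sum.inr id * M⁻¹.submatrix id Sum.inr = 1 := by
  rw [bottom_mul_rightCols, Matrix.mul_nonsing_inv M hM, one_submatrix_inr_inr]

/-- **Some maximal minor of the bottom row-block of an invertible matrix over a LOCAL ring is a unit** (the unit coordinate of the Plücker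
vector `π(h_v)` at a place where `h_v` is integral-invertible). [cite: GelbartPiatetskishapiroRallis1987, Part A §1] -/
theorem exists_isUnit_bottom_minor {R : Type*} [CommRing R] [IsLocalRing R] {ι : Type*} [Fintype ι] [DecidableEq ι]
    (M : Matrix (ι ⊕ ι) (ι ⊕ ι) R) (hM : IsUnit M.det) :
    ∃ φ : ι → ι ⊕ ι, IsUnit ((M.submatrix Sum.inr id).submatrix id φ).det :=
  exists_isUnit_det_submatrix_of_mul_eq_one _ _ (bottom_mul_rightCols_inv M hM)

end Summit.HodgeConjecture.HodgeConjecture.Cruxes.HLiu418.K2LiuCauchyBinetMinors
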